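import Summits.Ventures.CertifiedManyBodySolver.Observables.PhaseSeparationExclusionBoxZeeman
import Summits.Ventures.CertifiedManyBodySolver.Observables.PhaseSeparationExclusionBoxThermalFreeDilute
import HarnessLib

/-!
# Ventures/CertifiedManyBodySolver — Observables/PhaseSeparationExclusionBoxZeemanFreeDilute.lean: the FIELD (H-axis) competing-order word at `T > 0`
# with `s`-DEPENDENT anchors at BOTH outer densities (free-gas dilute anchor + constant or chorded `n₂`-anchor), column × threshold forms

HONEST FRAMING: a transport device; the Zeeman twin of `Observables/PhaseSeparationExclusionBoxThermalFreeDilute.lean` (g25). Law (this seat, g21):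
`IsTranslationInvariant.sub_mul_field_lt_pressureTT'Zeeman_mix_of_hotAnchors_of_threshold_of_abs_le` (`Literature/…/HubbardTTPrimePhaseCoexistenceExclusionZeeman.lean`):
ZERO-FIELD cap / floors / anchors with margin `M` exclude the `(≤ n₁ | ≥ n₂)` coexistence among canonical equilibrium states of `Φ(t,s,U) − h(n↑ − n↓)` for every
`|h| ≤ h₀` once `aπ₁ + bπ₂ + β_{h,1}aF₁ + β_{h,2}bF₂ < β₀(M − h₀·(an₁ + bn₂))` (`n₂ ≤ 1`). The forms below take BOTH pressure ceilings as functions `Q₁(s)`, `Q₂(s)`: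
`Q₁` = the `t′`-chord of two KERNEL free-gas ceilings (`pressureTT'_le_schord_of_freeGCPressureTT'`), `Q₂` = a producer-certified `n₂`-anchor. CONTROL class;
conditional on the rows / `n₂`-anchors an instance names; Zeeman coupling only (no orbital field); statements about canonical field equilibrium states
(variational sense); nothing about stripes, `H_c2`, SC or `T_c`; no number of record. Zero kit, no definition, no claim node.

Cell `pub/hubbard-downfold` (MO-S1 filling lane; D-0098 `H` axis), seat `hubbard-downfold-unc-2` (g25).
References: R. B. Israel (1979) Thm I.2.4 / I.3.4 [Israel1979]; E. H. Lieb, PRL 62 (1989) 1201 [LiebPRL1989]; R. B. Griffiths, J. Math. Phys. 5 (1964) 1215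
[Griffiths1964]; D. Poulin, M. B. Hastings, PRL 106 (2011) 080403 [PoulinHastings2011]; D. Ruelle (1969) §3.4 [Ruelle1969].
-/

noncomputable section

namespace Summit.Ventures.CertifiedManyBodySolver.Observables

open Literature.MathematicalPhysics.QuantumLattice Literature.MathematicalPhysics.QuantumLattice.ThermodynamicLimit
open Literature.MathematicalPhysics.QuantumLattice.InfVolFermionState Set Filter

/-- **FIELD THERMAL PS EXCLUSION, COLUMN × THRESHOLD FORM, `s`-DEPENDENT ANCHORS `Q₁(s)`, `Q₂(s)`** (as
`psHT_not_fieldEquilibrium_mix_on_cell_of_columns_hotAnchor` with both anchors functions of `s`): for every `|h| ≤ h₀` and every `(s, U)` of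
`[s₁, s₂] × [U₁, U₂]`, no mixture of translation-invariant states with densities `0 < ρ(ω₁) ≤ n₁`, `n₂ ≤ ρ(ω₂) < 2` (`n₂ ≤ 1`) is a canonical equilibrium
state of `Φ(t,s,U) − h(n↑ − n↓)` at `β ≥ β₀`. [cite: Israel1979, Thm. I.2.4] [cite: LiebPRL1989, proof of Theorem 1] [cite: PoulinHastings2011, eqs. (3)–(8)] -/
theorem psHT_not_fieldEquilibrium_mix_on_cell_of_columns_hotAnchorSS (t : ℝ)
    {s₁ s₂ U₁ U₂ n₁ n₂ a b c₀ c₁ β β₀ βh₁ βh₂ h₀ hz : ℝ}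
    (hU₁ : 0 ≤ U₁) (h12 : U₁ < U₂) (hn₁ : 0 ≤ n₁) (hn : n₁ < n₂) (hn₂ : n₂ ≤ 1) (ha : 0 ≤ a) (hb : 0 ≤ b)
    (hab : a + b = 1) (hβh₁ : 0 ≤ βh₁) (hβh₂ : 0 ≤ βh₂) (h0₁ : βh₁ ≤ β₀) (h0₂ : βh₂ ≤ β₀) (hβ₀ : β₀ ≤ β)
    (hβ₀pos : 0 < β₀) {L₁ L₂ F₁ Q₁ Q₂ : ℝ → ℝ}
    (hC : ∀ s ∈ Icc s₁ s₂, ∀ U ∈ Icc U₁ U₂, energyDensityTT' t s U (a * n₁ + b * n₂) ≤ c₀ + c₁ * U)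
    (hL₁ : ∀ s ∈ Icc s₁ s₂, L₁ s ≤ energyDensityTT' t s U₁ n₂) (hL₂ : ∀ s ∈ Icc s₁ s₂, L₂ s ≤ energyDensityTT' t s U₂ n₂)
    (hF₁ : ∀ s ∈ Icc s₁ s₂, ∀ U ∈ Icc U₁ U₂, F₁ s ≤ energyDensityTT' t s U n₁)
    (hπ₁ : ∀ s ∈ Icc s₁ s₂, ∀ U ∈ Icc U₁ U₂, pressureTT' βh₁ t s U n₁ ≤ Q₁ s)
    (hπ₂ : ∀ s ∈ Icc s₁ s₂, ∀ U ∈ Icc U₁ U₂, pressureTT' βh₂ t s U n₂ ≤ Q₂ s)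
    (hh : |hz| ≤ h₀)
    (hm₁ : ∀ s ∈ Icc s₁ s₂, 0 ≤ a * F₁ s + b * L₁ s - (c₀ + c₁ * U₁) - h₀ * (a * n₁ + b * n₂))
    (hm₂ : ∀ s ∈ Icc s₁ s₂, 0 ≤ a * F₁ s + b * L₂ s - (c₀ + c₁ * U₂) - h₀ * (a * n₁ + b * n₂))
    (hg₁ : ∀ s ∈ Icc s₁ s₂, a * Q₁ s + b * Q₂ s + βh₁ * (a * F₁ s) + βh₂ * (b * L₁ s) <
      β₀ * (a * F₁ s + b * L₁ s - (c₀ + c₁ * U₁) - h₀ * (a * n₁ + b * n₂)))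
    (hg₂ : ∀ s ∈ Icc s₁ s₂, a * Q₁ s + b * Q₂ s + βh₁ * (a * F₁ s) + βh₂ * (b * L₂ s) <
      β₀ * (a * F₁ s + b * L₂ s - (c₀ + c₁ * U₂) - h₀ * (a * n₁ + b * n₂)))
    {s : ℝ} (hs : s ∈ Icc s₁ s₂) {U : ℝ} (hU : U ∈ Icc U₁ U₂)
    {ω₁ ω₂ : InfVolFermionState 2} (h₁ : ω₁.IsTranslationInvariant) (h₂ : ω₂.IsTranslationInvariant)
    (hρ₁ : 0 < ω₁.density) (hρ₁' : ω₁.density ≤ n₁) (hρ₂ : n₂ ≤ ω₂.density) (hρ₂' : ω₂.density < 2)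
    {lam : ℝ} (hl0 : 0 < lam) (hl1 : lam < 1) :
    (mix lam hl0.le hl1.le ω₁ ω₂).entropyDensitySup -
        β * (mix lam hl0.le hl1.le ω₁ ω₂).meanEnergy (gcInteractionTT' t s U 0 hz) 1 <
      pressureTT'Zeeman β t s U (mix lam hl0.le hl1.le ω₁ ω₂).density hz := by
  have hn2' : 0 ≤ n₂ := hn₁.trans hn.le
  have hn₂2 : n₂ < 2 := by linarith
  have hβpos : 0 < β := hβ₀pos.trans_le hβ₀
  have hF₂ := floor_on_cell_of_columnLaws t hn2' hn₂2 hU₁ h12 hL₁ hL₂ s hs U hU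
  obtain ⟨hMnn, hM₀⟩ := hotAnchor_chord_slack (βh₁ := βh₁) (βh₂ := βh₂) (π₁ := Q₁ s) (π₂ := Q₂ s) h12 hU (hm₁ s hs) (hm₂ s hs)
    (hg₁ s hs) (hg₂ s hs)
  exact h₁.sub_mul_field_lt_pressureTT'Zeeman_mix_of_hotAnchors_of_threshold_of_abs_le t s (hU₁.trans hU.1) hβpos hz h₂ hρ₁
    hρ₂' hρ₁' hn hρ₂ hn₂ ha hb hab (hC s hs U hU) (hF₁ s hs U hU) hF₂ hβh₁ hβh₂ h0₁ h0₂ hβ₀ (hπ₁ s hs U hU) (hπ₂ s hs U hU)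
    hh hMnn hM₀ hl0 hl1

/-- **FIELD THERMAL PS EXCLUSION ABOVE A COLUMN, `s`-DEPENDENT ANCHORS `Q₁(s)`, `Q₂(s)`** (cap with `c₁ ≥ 0`, one column law, far-end checks at
`U₃` after the field cost `h₀·(an₁ + bn₂)`): the exclusion among canonical field equilibrium states holds on `[s₁, s₂] × [U₂, U₃]` at every `β ≥ β₀` and
every `|h| ≤ h₀`. [cite: Israel1979, Thm. I.2.4] [cite: Griffiths1964, Appendix] [cite: PoulinHastings2011, eqs. (3)–(8)] -/
theorem psHT_not_fieldEquilibrium_mix_above_column_hotAnchorSS (t : ℝ)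
    {s₁ s₂ U₂ U₃ n₁ n₂ a b c₀ c₁ β β₀ βh₁ βh₂ h₀ hz : ℝ}
    (hU₂ : 0 ≤ U₂) (hc₁ : 0 ≤ c₁) (hn₁ : 0 ≤ n₁) (hn : n₁ < n₂) (hn₂ : n₂ ≤ 1) (ha : 0 ≤ a) (hb : 0 ≤ b)
    (hab : a + b = 1) (hβh₁ : 0 ≤ βh₁) (hβh₂ : 0 ≤ βh₂) (h0₁ : βh₁ ≤ β₀) (h0₂ : βh₂ ≤ β₀) (hβ₀ : β₀ ≤ β) (hβ₀pos : 0 < β₀)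
    {L F₁ Q₁ Q₂ : ℝ → ℝ}
    (hC : ∀ s ∈ Icc s₁ s₂, ∀ U ∈ Icc U₂ U₃, energyDensityTT' t s U (a * n₁ + b * n₂) ≤ c₀ + c₁ * U)
    (hL : ∀ s ∈ Icc s₁ s₂, L s ≤ energyDensityTT' t s U₂ n₂)
    (hF₁ : ∀ s ∈ Icc s₁ s₂, ∀ U ∈ Icc U₂ U₃, F₁ s ≤ energyDensityTT' t s U n₁)
    (hπ₁ : ∀ s ∈ Icc s₁ s₂, ∀ U ∈ Icc U₂ U₃, pressureTT' βh₁ t s U n₁ ≤ Q₁ s)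
    (hπ₂ : ∀ s ∈ Icc s₁ s₂, ∀ U ∈ Icc U₂ U₃, pressureTT' βh₂ t s U n₂ ≤ Q₂ s)
    (hh : |hz| ≤ h₀)
    (hm : ∀ s ∈ Icc s₁ s₂, 0 ≤ a * F₁ s + b * L s - (c₀ + c₁ * U₃) - h₀ * (a * n₁ + b * n₂))
    (hg : ∀ s ∈ Icc s₁ s₂, a * Q₁ s + b * Q₂ s + βh₁ * (a * F₁ s) + βh₂ * (b * L s) <
      β₀ * (a * F₁ s + b * L s - (c₀ + c₁ * U₃) - h₀ * (a * n₁ + b * n₂)))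
    {s : ℝ} (hs : s ∈ Icc s₁ s₂) {U : ℝ} (hU : U ∈ Icc U₂ U₃)
    {ω₁ ω₂ : InfVolFermionState 2} (h₁ : ω₁.IsTranslationInvariant) (h₂ : ω₂.IsTranslationInvariant)
    (hρ₁ : 0 < ω₁.density) (hρ₁' : ω₁.density ≤ n₁) (hρ₂ : n₂ ≤ ω₂.density) (hρ₂' : ω₂.density < 2)
    {lam : ℝ} (hl0 : 0 < lam) (hl1 : lam < 1) :
    (mix lam hl0.le hl1.le ω₁ ω₂).entropyDensitySup -
        β * (mix lam hl0.le hl1.le ω₁ ω₂).meanEnergy (gcInteractionTT' t s U 0 hz) 1 <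
      pressureTT'Zeeman β t s U (mix lam hl0.le hl1.le ω₁ ω₂).density hz := by
  have hn2' : 0 ≤ n₂ := hn₁.trans hn.le
  have hn₂2 : n₂ < 2 := by linarith
  have hβpos : 0 < β := hβ₀pos.trans_le hβ₀
  have hF₂ := floor_above_column_of_law t hn2' hn₂2 hU₂ hL s hs U hU.1
  have k := mul_le_mul_of_nonneg_left hU.2 hc₁
  have hM3 := hm s hs
  have hM : a * F₁ s + b * L s - (c₀ + c₁ * U₃) - h₀ * (a * n₁ + b * n₂) ≤
      a * F₁ s + b * L s - (c₀ + c₁ * U) - h₀ * (a * n₁ + b * n₂) := by linarith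
  have hMU : 0 ≤ a * F₁ s + b * L s - (c₀ + c₁ * U) - h₀ * (a * n₁ + b * n₂) := hM3.trans hM
  have k1 := mul_le_mul_of_nonneg_left hM hβ₀pos.le
  have hg' := hg s hs
  have hM₀ : a * Q₁ s + b * Q₂ s + βh₁ * (a * F₁ s) + βh₂ * (b * L s) <
      β₀ * (a * F₁ s + b * L s - (c₀ + c₁ * U) - h₀ * (a * n₁ + b * n₂)) := by linarith
  exact h₁.sub_mul_field_lt_pressureTT'Zeeman_mix_of_hotAnchors_of_threshold_of_abs_le t s (hU₂.trans hU.1) hβpos hz h₂ hρ₁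
    hρ₂' hρ₁' hn hρ₂ hn₂ ha hb hab (hC s hs U hU) (hF₁ s hs U hU) hF₂ hβh₁ hβh₂ h0₁ h0₂ hβ₀ (hπ₁ s hs U hU) (hπ₂ s hs U hU)
    hh hMU hM₀ hl0 hl1

end Summit.Ventures.CertifiedManyBodySolver.Observables
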